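import Summits.BirchSwinnertonDyer.Rank1Residual.Iwasawa.RankGrowthCyclotomicFactor
import Summits.BirchSwinnertonDyer.Rank1Residual.Iwasawa.RankGrowthLayer
import Summits.BirchSwinnertonDyer.BirchSwinnertonDyer.Theorems.AlignedTransportAtTwoMainConjectureOfRankZeroBSDAtTwoCyclotomicLayerPrime
import Summits.BirchSwinnertonDyer.BirchSwinnertonDyer.Theorems.AlignedTransportAtTwoMainConjectureOfRankZeroBSDAtTwoCyclotomicLayerNorm
import HarnessLib

/-!
# Route `AlignedTransportAtTwo`, crux C2 `MainConjectureOfRankZeroBSDAtTwo` (stmt-BirchSwinnertonDyer-22298):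
# RANK GROWTH IN THE LAYER `K_{n+1}/K_n` PUTS `Φ_{p^{n+1}}(1+T)^t` INTO `char_Λ X(E/K_∞)` — GREENBERG'S p. 132 ARGUMENT AT EVERY LAYER

HONEST FRAMING (cell `bsd-f1-sign2`, WIDTH-5 attached prover seat `bsd-line-att-p5` gen 36 on line `birth` of the lead
`bsd-line-att-p2`; `--supports` stmt-BirchSwinnertonDyer-22298, closes nothing; BSD is NOT proved by any of this; the crux C2, its
verdict «blocked-on `Rank1Residual.GreenbergMuConjectureIrreducible`» and every registered stub are untouched). THEOREMS ONLY (no `def`,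
no instance, no named fact, no `sorry`; the classical `DecidableEq` on a layer `K_m` that the tree's Kummer maps carry is pinned by a term-level
`letI` inside the statements that form `P ⊗ e` or add points of `E(K_m)`, exactly the tree's reducible `decEqLayer`). This file is the lineage's successor item «layer-two cyclotomic divisibility» (EISENSTEIN-RIGIDITY memo §4
(iii), PRIMES-CONSERVATION memo §6 (ii)) for EVERY layer: the tree's `Rank1Residual/Iwasawa/RankGrowthCyclotomicFactor.lean`
(`xi_pow_dvd_of_mem_charIdeal_of_rank_le`: rank growth in the FIRST layer puts `ξ_p^t = Φ_p(1+T)^t` into `char_Λ X`) is the case `n = 0`.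

**Theorem (`cyclotomicLayer_pow_dvd_of_mem_charIdeal_of_rank_le`).** Let `E/K` be an elliptic curve over a number field, `K_∞ = ⋃ K_n`
ANY `ℤ_p`-extension of `K` (`κ`) with topological generator `γ`, and `D` a Pontryagin-dual datum of `Sel_{p^∞}(E/K_∞)` whose Iwasawa module
`X` is finitely generated and `Λ`-torsion (`T = γ − 1`). If **`rank E(K_{n+1}) ≥ rank E(K_n) + pⁿ(p−1)·t`** then
**`Φ_{p^{n+1}}(1+T)^t ∣ f` for every `f ∈ char_Λ X`** (`Φ_{p^{n+1}}(1+T) = ∑_{i<p} (1+T)^{pⁿ i}`, spelled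
`(((cyclotomic (p ^ (n+1)) ℤ_[p]).comp (X + 1) : ℤ_[p][X]) : Λ)`; no definition is introduced). No reduction hypothesis at `p`, no
cyclotomicity; over the cyclotomic tower of a number field the finiteness hypothesis is automatic (`…_of_isCyclotomic`).

PROOF (Greenberg, LNM 1716, §5 p. 132, «`E(F) ⊗ (ℚ_p/ℤ_p)` is a `Λ`-submodule of `Sel_E(ℚ_∞)_p`, it follows that `θ_1^t` divides `f_E(T)`»,
run in the layer `K_{n+1}/K_n`). Arithmetic (`…CyclotomicLayerNorm`): `r = pⁿ(p−1)t` points `P_i ∈ E(K_{n+1})` killed by the relative norm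
`∑_{j<p} (γ^{pⁿ})^j` with dual functionals `λ_k`, `λ_k(P_i) = N₀δ_{ki}`. Kummer theory of the layer `K_{n+1}` (tree
`Greenberg1999/MordellWeilRankLayerBoundProofs`): `θ : E(K_{n+1}) ⊗ ℚ_p/ℤ_p → Sel_{p^∞}(E/K_∞)` with kernel killed by `p^a`; the characters
`p^a c₀(λ_k(·)·)` descend, extend and lift to `x_k ∈ X` exactly as in the tree proof of Thm. 1.9. §1–§2 here: `(1+T)^i` acts on `X` as
`conj_γ^i` and `conj_γ^i θ(P ⊗ e) = θ(γ^i·P ⊗ e)` AT EVERY LAYER (`conjSel_iterate_kummerLayerToInfty_layer`), so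
`(Φ_{p^{n+1}}(1+T) · y)(θ(P ⊗ e)) = ∑_{j<p} y(θ(γ^{pⁿ j}·P ⊗ e)) = y(θ((∑_j (γ^{pⁿ})^j·P) ⊗ e)) = 0` for `P` killed by the relative norm
(`toDual_cyclotomicLayer_smul_kummerLayerToInfty_eq_zero`). Hence a relation `∑ c_k x_k ∈ Φ_{p^{n+1}}(1+T)·X` evaluated at `θ(P_i ⊗ [p^{−N}])`
gives `p^N ∣ (c_i mod p^N)·p^a N₀` for all `N`, so `c = 0`: the `x_k` are `ℤ_p`-independent modulo `Φ_{p^{n+1}}(1+T)·X`, and the algebra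
(`…CyclotomicLayerPrime`: `Φ_{p^{n+1}}(1+T)` is PRIME in `Λ` with `Λ/(Φ) ` free of rank `pⁿ(p−1)`) gives the divisibility.

§4 draws the curve-over-`ℚ` reading in the cell's currency: `…_of_layerRankGEAt` (the typed certificate `Iwasawa.LayerRankGEAt W p (n+1) m`
together with a rank bound at layer `n`). The road consequences (`a₂ = +1`: a jump at a layer `k ≥ 2` forces `λ₂ = 2^{k−1} + 1`) are in `…CyclotomicLayerRoad`.

References: R. Greenberg, LNM 1716 (1999), Thm. 1.9 (p. 63), Lemma 3.1 (p. 86), §5 p. 132 [GreenbergLNM1716]; L. C. Washington,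
*Introduction to Cyclotomic Fields*, §13.1–13.2 [Washington1997].
-/

set_option linter.dupNamespace false
set_option autoImplicit false

noncomputable section

open scoped Classical TensorProduct Polynomial

namespace Summit.BirchSwinnertonDyer.BirchSwinnertonDyer.Theorems.AlignedTransportAtTwoCyclotomicLayerRankGrowth

open Polynomial WeierstrassCurve WeierstrassCurve.LayerKummer Literature.NumberTheory.EllipticCurves
  Summit.BirchSwinnertonDyer.Rank1Residual.X1.CyclotomicZeros
  Summit.BirchSwinnertonDyer.Rank1Residual.Iwasawa
  Summit.BirchSwinnertonDyer.BirchSwinnertonDyer.Theorems.AlignedTransportAtTwoCyclotomicLayerPrime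
  Summit.BirchSwinnertonDyer.BirchSwinnertonDyer.Theorems.AlignedTransportAtTwoCyclotomicLayerNorm

universe u

/-! ## §1 `Φ_{p^{n+1}}(1+T)` acts on `X` as `∑_{j<p} conj_γ^{pⁿ j}` on `Sel_∞` -/

section Dual

variable {K : Type u} [Field K] [NumberField K] {W : WeierstrassCurve K} {p : ℕ} [hp : Fact p.Prime]
  {κ : ZpExtension K p} {γ : Field.absoluteGaloisGroup K} (D : W.SelmerDualData κ γ)

/-- **`(Φ_{p^{n+1}}(1+T) · y)(s) = ∑_{j<p} y(conj_γ^{pⁿ j} s)`** (`Φ_{p^{n+1}}(1+T) = ∑_{j<p} (1+T)^{pⁿ j}` and `1 + T` acts on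
`X = Hom(Sel_∞, ℚ/ℤ)` as `conj_γ`, tree `toDual_one_add_X_pow_smul`). [cite: GreenbergLNM1716, §1 p. 53] -/
theorem toDual_cyclotomicLayer_smul (n : ℕ) (y : D.X) (s : W.selmerInfty κ) :
    D.toDual ((((cyclotomic (p ^ (n + 1)) ℤ_[p]).comp (X + 1) : ℤ_[p][X]) : PowerSeries ℤ_[p]) • y) s =
      ∑ j ∈ Finset.range p, D.toDual y ((conjSel D)^[p ^ n * j] s) := by
  rw [coe_cyclotomicLayer_eq_sum, Finset.sum_smul, map_sum, AddMonoidHom.finsetSum_apply]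
  exact Finset.sum_congr rfl fun j _ ↦ by rw [← pow_mul]; exact toDual_one_add_X_pow_smul D y _ s

end Dual

/-! ## §2 `conj_γ θ(P ⊗ e) = θ(γ·P ⊗ e)` for the Kummer map of EVERY layer `K_m` -/

section Conj

variable {K : Type u} [Field K] [NumberField K] (W : WeierstrassCurve K) [W.IsElliptic] {p : ℕ}
  [hp : Fact p.Prime] (κ : ZpExtension K p) (γ : Field.absoluteGaloisGroup K)
  (hdiv : W.zsmul_geomPoints_surjective)

/-- **Conjugation moves the Kummer classes of the layer `K_m`**: `conj_σ θ(P ⊗ e_N) = θ(σ·P ⊗ e_N)` in `H¹(K_∞, E[p^∞])`, `θ = h_m ∘ κ_∞`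
the Kummer map of `E(K_m)` followed by restriction (`kummerLayerToInfty`), `σ·P` the descended Galois action `layerGal` (the tree's
`conjH1_kummerLayerToInfty` is `m = 1`; same proof). [cite: GreenbergLNM1716, §3 p. 86 and §5 p. 132] -/
theorem conjH1_kummerLayerToInfty_layer (m N : ℕ) (σ : Field.absoluteGaloisGroup K)
    (P : (W.baseChange (κ.layer m)).toAffine.Point) :
    letI : DecidableEq (κ.layer m) := fun a b ↦ Classical.propDecidable (a = b)
    W.conjH1 p κ.kerSubgroup σ (kummerLayerToInfty W κ hdiv m (P ⊗ₜ[ℤ] prufGen p N) :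
        W.subgroupH1 p κ.kerSubgroup) =
      kummerLayerToInfty W κ hdiv m (layerGal W κ m σ P ⊗ₜ[ℤ] prufGen p N) := by
  letI : ∀ m, DecidableEq (κ.layer m) := fun m a b ↦ Classical.propDecidable (a = b)
  obtain ⟨Q, hQ⟩ := exists_nsmul_eq_geomPoints W hdiv (pow_ne_zero N hp.out.ne_zero) (layerPointsMap W κ m P)
  have hQ' : p ^ N • (σ • Q) = layerPointsMap W κ m (layerGal W κ m σ P) := by
    rw [smul_comm, hQ, layerPointsMap_layerGal]
  rw [coe_kummerLayerToInfty, coe_kummerLayerToInfty, kummerMap_tmul_prufGen, kummerMap_tmul_prufGen,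
    levelMap_eq_kclass W p (κ.layerSubgroup m) (layerPointsMap W κ m) (smul_layerPointsMap W κ m) hdiv N P Q hQ,
    levelMap_eq_kclass W p (κ.layerSubgroup m) (layerPointsMap W κ m) (smul_layerPointsMap W κ m) hdiv N _ (σ • Q) hQ',
    conjH1_layerToInfty, conjH1_kclass]

variable {W κ γ}

/-- Iterated form on `Sel_∞`, any layer: `conj_γ^i θ(P ⊗ e_N) = θ(γ^i·P ⊗ e_N)`. [cite: GreenbergLNM1716, §3 p. 86 and §5 p. 132] -/
theorem conjSel_iterate_kummerLayerToInfty_layer (D : W.SelmerDualData κ γ) (m i N : ℕ)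
    (P : (W.baseChange (κ.layer m)).toAffine.Point) :
    letI : DecidableEq (κ.layer m) := fun a b ↦ Classical.propDecidable (a = b)
    (conjSel D)^[i] (kummerLayerToInfty W κ hdiv m (P ⊗ₜ[ℤ] prufGen p N)) =
      kummerLayerToInfty W κ hdiv m ((layerGal W κ m γ)^[i] P ⊗ₜ[ℤ] prufGen p N) := by
  letI : ∀ m, DecidableEq (κ.layer m) := fun m a b ↦ Classical.propDecidable (a = b)
  induction i with
  | zero => rfl
  | succ i ih =>
    rw [Function.iterate_succ_apply', Function.iterate_succ_apply', ih]
    exact Subtype.ext (conjH1_kummerLayerToInfty_layer W κ hdiv m N γ _)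

omit [NumberField K] [W.IsElliptic] in
/-- `(σ·)^[k] = (σ^k)·` for the descended action on `E(K_m)` (both have image `σ^k • ι(P)` under the injective `ι`). [folklore] -/
theorem layerGal_iterate_apply (m k : ℕ) (σ : Field.absoluteGaloisGroup K) (P : (W.baseChange (κ.layer m)).toAffine.Point) :
    (layerGal W κ m σ)^[k] P = layerGal W κ m (σ ^ k) P := by
  apply layerPointsMap_injective W κ m
  rw [layerPointsMap_layerGal_iterate, layerPointsMap_layerGal]

/-- **`(Φ_{p^{n+1}}(1+T) · y)(θ(P ⊗ e_N)) = 0` for `P ∈ E(K_{n+1})` killed by the relative norm**: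
`= ∑_{j<p} y(conj_γ^{pⁿ j} θ(P ⊗ e)) = y(θ((∑_{j<p} (γ^{pⁿ})^j · P) ⊗ e)) = y(θ(0)) = 0`. Greenberg's sentence «`E(F) ⊗ (ℚ_p/ℤ_p)` is a
`Λ`-submodule of `Sel_E(ℚ_∞)_p`, it follows that `θ^t` divides `f_E(T)`» at layer `n+1`, for one test class. [cite: GreenbergLNM1716, §5 p. 132] -/
theorem toDual_cyclotomicLayer_smul_kummerLayerToInfty_eq_zero (D : W.SelmerDualData κ γ) (n : ℕ) (y : D.X) (N : ℕ) :
    letI : DecidableEq (κ.layer (n + 1)) := fun a b ↦ Classical.propDecidable (a = b)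
    ∀ {P : (W.baseChange (κ.layer (n + 1))).toAffine.Point},
      ∑ j ∈ Finset.range p, (layerGal W κ (n + 1) (γ ^ p ^ n))^[j] P = 0 →
      D.toDual ((((cyclotomic (p ^ (n + 1)) ℤ_[p]).comp (X + 1) : ℤ_[p][X]) : PowerSeries ℤ_[p]) • y)
        (kummerLayerToInfty W κ hdiv (n + 1) (P ⊗ₜ[ℤ] prufGen p N)) = 0 := by
  letI : ∀ m, DecidableEq (κ.layer m) := fun m a b ↦ Classical.propDecidable (a = b)
  intro P hP
  rw [toDual_cyclotomicLayer_smul]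
  simp_rw [conjSel_iterate_kummerLayerToInfty_layer hdiv D]
  have e : ∀ j : ℕ, (layerGal W κ (n + 1) γ)^[p ^ n * j] P = (layerGal W κ (n + 1) (γ ^ p ^ n))^[j] P := fun j ↦ by
    rw [layerGal_iterate_apply, layerGal_iterate_apply, pow_mul]
  simp_rw [e]
  rw [← map_sum, ← map_sum, ← TensorProduct.sum_tmul, hP, TensorProduct.zero_tmul, map_zero, map_zero]

end Conj

/-! ## §3 The theorem -/

section Main

variable {K : Type u} [Field K] [NumberField K] (W : WeierstrassCurve K) [W.IsElliptic] {p : ℕ}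
  [hp : Fact p.Prime] {κ : ZpExtension K p} {γ : Field.absoluteGaloisGroup K}

/-- ★★ **THE CORE: `r` points of `E(K_{n+1})` killed by the relative norm, with dual functionals, put `Φ_{p^{n+1}}(1+T)^t` into `char_Λ X` for
`pⁿ(p−1)·t ≤ r`** (Greenberg p. 132 at every layer; the divisibility of `E(K̄)` is the hypothesis `hdiv`, discharged below). For `E/K` elliptic over
a number field, ANY `ℤ_p`-extension `κ` with topological generator `γ`, a dual datum `D` with `X = D.X` finitely generated and `Λ`-torsion, `f ∈ char_Λ X`,
points `P_i ∈ E(K_{n+1})` (`i < r`) with `∑_{j<p} (γ^{pⁿ})^j · P_i = 0` and functionals `λ_k : E(K_{n+1}) → ℤ` with `λ_k(P_i) = N₀δ_{ki}`, `N₀ ≠ 0`: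
`pⁿ(p−1)·t ≤ r ⇒ Φ_{p^{n+1}}(1+T)^t ∣ f`. (The points may come from a rank jump — `…_of_rank_le` — or from ANY sublattice killed by the norm, e.g. the
full kernel lattice of the relative norm.) PROOF: module docstring. [cite: GreenbergLNM1716, §5 p. 132 and Thm. 1.9 (p. 63)] -/
theorem cyclotomicLayer_pow_dvd_of_mem_charIdeal_of_points_functionals (hdiv : W.zsmul_geomPoints_surjective)
    (hγ : κ.IsTopGenerator γ) (D : W.SelmerDualData κ γ) [Module.Finite (IwasawaAlgebra p) D.X]
    (hD : D.IsTorsion) {f : IwasawaAlgebra p} (hf : f ∈ D.charIdeal) (n : ℕ) {r t : ℕ} (hrt : p ^ n * (p - 1) * t ≤ r) :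
    letI : DecidableEq (κ.layer (n + 1)) := fun a b ↦ Classical.propDecidable (a = b)
    ∀ (P : Fin r → (W.baseChange (κ.layer (n + 1))).toAffine.Point)
      (lam : Fin r → ((W.baseChange (κ.layer (n + 1))).toAffine.Point →ₗ[ℤ] ℤ)) (N₀ : ℕ), N₀ ≠ 0 →
      (∀ i, ∑ j ∈ Finset.range p, (layerGal W κ (n + 1) (γ ^ p ^ n))^[j] (P i) = 0) →
      (∀ k i, lam k (P i) = if k = i then (N₀ : ℤ) else 0) →
    (((cyclotomic (p ^ (n + 1)) ℤ_[p]).comp (X + 1) : ℤ_[p][X]) : PowerSeries ℤ_[p]) ^ t ∣ f := by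
  letI : ∀ m, DecidableEq (κ.layer m) := fun m a b ↦ Classical.propDecidable (a = b)
  intro P lam N₀ hN₀ hPA hlam
  haveI : FiniteDimensional K (κ.layer (n + 1)) := κ.finiteDimensional_layer_holds (n + 1)
  haveI : NumberField (κ.layer (n + 1)) := NumberField.of_module_finite K (κ.layer (n + 1))
  obtain ⟨c₀, hc₀⟩ := exists_character_prufGen p
  let c₀' : PruferQuot p →+ AddCircle (1 : ℚ) := c₀
  have hc₀' : ∀ t, c₀' t = c₀ t := fun _ ↦ rfl
  obtain ⟨a, ha⟩ := exists_pow_smul_ker_kummerLayerToInfty W hdiv hγ (n + 1) (p := p)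
  let θ := kummerLayerToInfty W κ hdiv (n + 1) (p := p)
  -- the characters `χ_k` of `E(K_{n+1}) ⊗ ℚ_p/ℤ_p`, multiplied by `p^a`
  let χ : Fin r →
      ((W.baseChange (κ.layer (n + 1))).toAffine.Point ⊗[ℤ] PruferQuot p →+ AddCircle (1 : ℚ)) :=
    fun k ↦ (c₀'.toIntLinearMap ∘ₗ (TensorProduct.lid ℤ (PruferQuot p)).toLinearMap ∘ₗ
      ((lam k).rTensor (PruferQuot p))).toAddMonoidHom
  have hχ : ∀ k Q (t : PruferQuot p), χ k (Q ⊗ₜ t) = c₀' (lam k Q • t) := fun k Q t ↦ by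
    simp [χ]
  let χ' : Fin r →
      ((W.baseChange (κ.layer (n + 1))).toAffine.Point ⊗[ℤ] PruferQuot p →+ AddCircle (1 : ℚ)) :=
    fun k ↦ (nsmulAddMonoidHom (p ^ a)).comp (χ k)
  have hχ' : ∀ k t, χ' k t = p ^ a • χ k t := fun k t ↦ rfl
  have hker : ∀ k, θ.rangeRestrict.ker ≤ (χ' k).ker := by
    intro k t ht
    rw [AddMonoidHom.mem_ker] at ht ⊢
    have ht' : t ∈ θ.ker := by
      rw [AddMonoidHom.mem_ker]
      exact congrArg (fun z : θ.range ↦ (z : W.selmerInfty κ)) ht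
    rw [hχ', ← map_nsmul, ha t ht', map_zero]
  -- descend to `range θ`
  have hsurj : Function.Surjective θ.rangeRestrict := AddMonoidHom.rangeRestrict_surjective θ
  let ψ : Fin r → (θ.range →+ AddCircle (1 : ℚ)) := fun k ↦
    θ.rangeRestrict.liftOfSurjective hsurj ⟨χ' k, hker k⟩
  have hψ : ∀ k t, ψ k (θ.rangeRestrict t) = χ' k t := fun k t ↦
    AddMonoidHom.liftOfRightInverse_comp_apply _ _ _ _ t
  -- extend to characters of `Sel_∞` (injectivity of `ℚ/ℤ`)
  have hext : ∀ k, ∃ xt : W.selmerInfty κ →+ AddCircle (1 : ℚ), ∀ g : θ.range, xt g = ψ k g := by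
    intro k
    obtain ⟨xt, hxt⟩ := CharacterModule.dual_surjective_of_injective
      (θ.range.subtype.toIntLinearMap) (fun a b h ↦ Subtype.ext h) (ψ k)
    refine ⟨xt, fun g ↦ ?_⟩
    have := DFunLike.congr_fun hxt g
    rw [CharacterModule.dual_apply] at this
    exact this
  choose xt hxt using hext
  -- lift to `X` along `toDual`
  have hX : ∀ k, ∃ x : D.X, D.toDual x = xt k := fun k ↦ D.bijective.2 (xt k)
  choose x hx using hX
  -- values of the characters on the test elements `θ(P_i ⊗ [p^{-N}])`
  have hval : ∀ k i N, xt k (θ (P i ⊗ₜ[ℤ] prufGen p N)) =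
      (p ^ a * if k = i then N₀ else 0) • c₀' (prufGen p N) := by
    intro k i N
    have e1 : θ (P i ⊗ₜ[ℤ] prufGen p N) =
        ((θ.rangeRestrict (P i ⊗ₜ[ℤ] prufGen p N) : θ.range) : W.selmerInfty κ) := rfl
    rw [e1, hxt k, hψ k, hχ', hχ, hlam k i]
    split_ifs with hki
    · rw [map_zsmul, natCast_zsmul, smul_smul]
    · simp
  -- a relation `∑ c_k x_k = Φ y` forces `c = 0`: evaluate at the test elements
  have hx0 : ∀ (c : Fin r → ℤ_[p]) (y : D.X),
      ∑ k, (PowerSeries.C (c k) : IwasawaAlgebra p) • x k =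
        (((cyclotomic (p ^ (n + 1)) ℤ_[p]).comp (X + 1) : ℤ_[p][X]) : PowerSeries ℤ_[p]) • y → ∀ k, c k = 0 := by
    intro c y hcy i
    have hdvd : ∀ N, p ^ N ∣ (PadicInt.toZModPow N (c i)).val * (p ^ a * N₀) := by
      intro N
      have hsN : p ^ N • θ (P i ⊗ₜ[ℤ] prufGen p N) = 0 := by
        rw [← map_nsmul, ← natCast_zsmul, ← TensorProduct.tmul_smul, zsmul_prufGen_self,
          TensorProduct.tmul_zero, map_zero]
      have hC : ∀ (c' : ℤ_[p]) (x' : D.X),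
          D.toDual (PowerSeries.C c' • x') (θ (P i ⊗ₜ[ℤ] prufGen p N)) =
            (PadicInt.toZModPow N c').val • D.toDual x' (θ (P i ⊗ₜ[ℤ] prufGen p N)) :=
        fun c' x' ↦ D.toDual_C_smul c' x' _ N hsN
      have h1 := congrArg (fun w ↦ D.toDual w (θ (P i ⊗ₜ[ℤ] prufGen p N))) hcy
      beta_reduce at h1
      rw [toDual_cyclotomicLayer_smul_kummerLayerToInfty_eq_zero hdiv D n y N (hPA i), map_sum,
        AddMonoidHom.finsetSum_apply] at h1
      simp_rw [hC, hx, hval] at h1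
      rw [Finset.sum_eq_single i (fun k _ hk ↦ by rw [if_neg hk, mul_zero, zero_smul, smul_zero])
        (fun h ↦ (h (Finset.mem_univ i)).elim),
        if_pos rfl, smul_smul] at h1
      have h2 := addOrderOf_dvd_iff_nsmul_eq_zero.mpr h1
      rwa [hc₀', hc₀ N] at h2
    exact padicInt_eq_zero_of_forall_dvd (c i) (mul_ne_zero (pow_ne_zero _ hp.out.ne_zero) hN₀) hdvd
  -- the algebra of `Φ_{p^{n+1}}(1+T)`
  exact cyclotomicLayer_pow_dvd_of_mem_charIdeal_of_indep p n D.X hD x hx0 hrt hf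

/-- ★★ **Rank growth in the layer `K_{n+1}/K_n` ⇒ `Φ_{p^{n+1}}(1+T)^t ∣ char_Λ X`** (Greenberg p. 132 at every layer), with the divisibility
of `E(K̄)` as hypothesis `hdiv` (discharged in `cyclotomicLayer_pow_dvd_of_mem_charIdeal_of_rank_le`): `rank E(K_n) + pⁿ(p−1)·t ≤ rank E(K_{n+1})`
supplies the points and functionals of the core (companion `…CyclotomicLayerNorm.exists_points_functionals_relNorm`).
[cite: GreenbergLNM1716, §5 p. 132 and Thm. 1.9 (p. 63)] -/
theorem cyclotomicLayer_pow_dvd_of_mem_charIdeal_of_rank_le_of (hdiv : W.zsmul_geomPoints_surjective)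
    (hγ : κ.IsTopGenerator γ) (D : W.SelmerDualData κ γ) [Module.Finite (IwasawaAlgebra p) D.X]
    (hD : D.IsTorsion) {f : IwasawaAlgebra p} (hf : f ∈ D.charIdeal) (n : ℕ) {t : ℕ}
    (ht : (W.baseChange (κ.layer n)).mordellWeilRank + p ^ n * (p - 1) * t ≤
      (W.baseChange (κ.layer (n + 1))).mordellWeilRank) :
    (((cyclotomic (p ^ (n + 1)) ℤ_[p]).comp (X + 1) : ℤ_[p][X]) : PowerSeries ℤ_[p]) ^ t ∣ f := by
  obtain ⟨P, lam, N₀, hN₀, hPA, hlam⟩ := exists_points_functionals_relNorm W κ n hγ ht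
  exact cyclotomicLayer_pow_dvd_of_mem_charIdeal_of_points_functionals W hdiv hγ D hD hf n le_rfl P lam N₀ hN₀ hPA hlam

/-- ★★★ **RANK GROWTH IN THE LAYER `K_{n+1}/K_n` ⇒ `Φ_{p^{n+1}}(1+T)^t ∣ char_Λ X(E/K_∞)`, UNCONDITIONALLY** (the Γ-EQUIVARIANT refinement of
Greenberg's Thm. 1.9 at every layer; his argument for `34A1`, LNM 1716 §5 p. 132, as a theorem): for an elliptic curve `E/K` over a number
field, ANY `ℤ_p`-extension `K_∞ = ⋃ K_n` of `K` with topological generator `γ`, and any Pontryagin-dual datum `D` of `Sel_{p^∞}(E/K_∞)` with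
`X = D.X` finitely generated and torsion over `Λ = ℤ_p⟦T⟧` (`T = γ − 1`): if **`rank_ℤ E(K_n) + pⁿ(p−1)·t ≤ rank_ℤ E(K_{n+1})`** then
**`Φ_{p^{n+1}}(1+T)^t`** (`= (∑_{i<p}(1+T)^{pⁿ i})^t`) **divides every `f ∈ char_Λ X`.** No reduction hypothesis at `p`, no cyclotomicity. The case
`n = 0` is the tree's `xi_pow_dvd_of_mem_charIdeal_of_rank_le`. [cite: GreenbergLNM1716, §5 p. 132 and Thm. 1.9 (p. 63)] -/
theorem cyclotomicLayer_pow_dvd_of_mem_charIdeal_of_rank_le (hγ : κ.IsTopGenerator γ)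
    (D : W.SelmerDualData κ γ) [Module.Finite (IwasawaAlgebra p) D.X] (hD : D.IsTorsion)
    {f : IwasawaAlgebra p} (hf : f ∈ D.charIdeal) (n : ℕ) {t : ℕ}
    (ht : (W.baseChange (κ.layer n)).mordellWeilRank + p ^ n * (p - 1) * t ≤
      (W.baseChange (κ.layer (n + 1))).mordellWeilRank) :
    (((cyclotomic (p ^ (n + 1)) ℤ_[p]).comp (X + 1) : ℤ_[p][X]) : PowerSeries ℤ_[p]) ^ t ∣ f :=
  cyclotomicLayer_pow_dvd_of_mem_charIdeal_of_rank_le_of W W.zsmul_geomPoints_surjective_holds hγ D hD hf n ht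

/-- Generator form: `char_Λ X = (f_E)` and `rank E(K_n) + pⁿ(p−1)·t ≤ rank E(K_{n+1})` ⇒ `Φ_{p^{n+1}}(1+T)^t ∣ f_E`.
[cite: GreenbergLNM1716, §5 p. 132] -/
theorem cyclotomicLayer_pow_dvd_of_charIdeal_eq_span_of_rank_le (hγ : κ.IsTopGenerator γ)
    (D : W.SelmerDualData κ γ) [Module.Finite (IwasawaAlgebra p) D.X] (hD : D.IsTorsion)
    {fE : IwasawaAlgebra p} (hfE : D.charIdeal = Ideal.span {fE}) (n : ℕ) {t : ℕ}
    (ht : (W.baseChange (κ.layer n)).mordellWeilRank + p ^ n * (p - 1) * t ≤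
      (W.baseChange (κ.layer (n + 1))).mordellWeilRank) :
    (((cyclotomic (p ^ (n + 1)) ℤ_[p]).comp (X + 1) : ℤ_[p][X]) : PowerSeries ℤ_[p]) ^ t ∣ fE :=
  cyclotomicLayer_pow_dvd_of_mem_charIdeal_of_rank_le W hγ D hD (hfE ▸ Ideal.mem_span_singleton_self fE) n ht

/-- `t = 1`: **ONE "new" irreducible constituent** (`rank E(K_{n+1}) ≥ rank E(K_n) + pⁿ(p−1)`) **puts `Φ_{p^{n+1}}(1+T)` into `char_Λ X`.**
[cite: GreenbergLNM1716, §5 p. 132] -/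
theorem cyclotomicLayer_dvd_of_charIdeal_eq_span_of_rank_le (hγ : κ.IsTopGenerator γ)
    (D : W.SelmerDualData κ γ) [Module.Finite (IwasawaAlgebra p) D.X] (hD : D.IsTorsion)
    {fE : IwasawaAlgebra p} (hfE : D.charIdeal = Ideal.span {fE}) (n : ℕ)
    (h1 : (W.baseChange (κ.layer n)).mordellWeilRank + p ^ n * (p - 1) ≤
      (W.baseChange (κ.layer (n + 1))).mordellWeilRank) :
    (((cyclotomic (p ^ (n + 1)) ℤ_[p]).comp (X + 1) : ℤ_[p][X]) : PowerSeries ℤ_[p]) ∣ fE := by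
  simpa using cyclotomicLayer_pow_dvd_of_charIdeal_eq_span_of_rank_le W hγ D hD hfE n (t := 1) (by simpa using h1)

/-- **Cyclotomic tower over a number field, no finiteness hypothesis**: over `K_∞^{cyc}` the module `X` is finitely generated over `Λ`
unconditionally (tree `SelmerDualData.module_finite_of_isCyclotomic`), so only `Λ`-torsion remains as a hypothesis.
[cite: GreenbergLNM1716, §5 p. 132 and §1 p. 60] -/
theorem cyclotomicLayer_pow_dvd_of_charIdeal_eq_span_of_rank_le_of_isCyclotomic (hκ : κ.IsCyclotomic)
    (hγ : κ.IsTopGenerator γ) (D : W.SelmerDualData κ γ) (hD : D.IsTorsion)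
    {fE : IwasawaAlgebra p} (hfE : D.charIdeal = Ideal.span {fE}) (n : ℕ) {t : ℕ}
    (ht : (W.baseChange (κ.layer n)).mordellWeilRank + p ^ n * (p - 1) * t ≤
      (W.baseChange (κ.layer (n + 1))).mordellWeilRank) :
    (((cyclotomic (p ^ (n + 1)) ℤ_[p]).comp (X + 1) : ℤ_[p][X]) : PowerSeries ℤ_[p]) ^ t ∣ fE := by
  haveI : Module.Finite (IwasawaAlgebra p) D.X := D.module_finite_of_isCyclotomic W κ hκ hγ
  exact cyclotomicLayer_pow_dvd_of_charIdeal_eq_span_of_rank_le W hγ D hD hfE n ht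

end Main


/-! ## §4 Curves over `ℚ`: the cell's rank certificate `LayerRankGEAt` at layer `n+1` against a rank bound at layer `n` -/

section OverRat

variable (W : WeierstrassCurve ℚ) [W.IsElliptic] {p : ℕ} [hp : Fact p.Prime]
  {κ : ZpExtension ℚ p} {γ : Field.absoluteGaloisGroup ℚ}

/-- **Cell currency.** `W/ℚ`, the cyclotomic `ℤ_p`-extension `κ` with topological generator `γ`, a dual datum `D` (torsion) with
`char_Λ X = (f_E)`: the typed certificate `Iwasawa.LayerRankGEAt W p (n+1) m` (`rank W(ℚ_{n+1}) ≥ m`) together with a bound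
`rank W(ℚ_n) + pⁿ(p−1)·t ≤ m` puts `Φ_{p^{n+1}}(1+T)^t` into `f_E`. (At `p = 2`: `rank W(ℚ_{n+1}) ≥ rank W(ℚ_n) + 2ⁿ·t ⇒ Φ_{2^{n+1}}(1+T)^t ∣ f_E`;
`n = 1`: `Φ₄(1+T) = T² + 2T + 2`.) [cite: GreenbergLNM1716, §5 p. 132 and Thm. 1.9 (p. 63)] -/
theorem cyclotomicLayer_pow_dvd_of_layerRankGEAt (hκ : κ.IsCyclotomic) (hγ : κ.IsTopGenerator γ)
    (D : W.SelmerDualData κ γ) (hD : D.IsTorsion) {fE : IwasawaAlgebra p} (hfE : D.charIdeal = Ideal.span {fE}) (n : ℕ)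
    {m t : ℕ} (hm : LayerRankGEAt W p (n + 1) m) (ht : (W.baseChange (κ.layer n)).mordellWeilRank + p ^ n * (p - 1) * t ≤ m) :
    (((cyclotomic (p ^ (n + 1)) ℤ_[p]).comp (X + 1) : ℤ_[p][X]) : PowerSeries ℤ_[p]) ^ t ∣ fE :=
  cyclotomicLayer_pow_dvd_of_charIdeal_eq_span_of_rank_le_of_isCyclotomic W hκ hγ D hD hfE n (ht.trans (hm κ hκ))

end OverRat

end Summit.BirchSwinnertonDyer.BirchSwinnertonDyer.Theorems.AlignedTransportAtTwoCyclotomicLayerRankGrowth
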